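import Mathlib
import Literature.Analysis.FluidPDE.VectorCalculus
import Literature.Analysis.FluidPDE.VortexFilament.CurlEnergy
import Summits.NavierStokesRegularity.NavierStokesRegularity.Theorems.FilamentSkeletonRssSelectionBoxRJRungSlipLaw
import Summits.NavierStokesRegularity.NavierStokesRegularity.Theorems.FilamentSkeletonRssSelectionBoxRJRungBending
import Summits.NavierStokesRegularity.NavierStokesRegularity.Theorems.FilamentSkeletonRssSelectionBoxRJRungModelArcTools
import Summits.NavierStokesRegularity.NavierStokesRegularity.Theorems.FilamentSkeletonRssSelectionBoxRJRungModelProfileMargins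

/-!
# Route `FilamentSkeletonRss` · crux `SelectionBoxRJ` (stmt-NavierStokesRegularity-21220) — rung tools (R1):
# the slip of a near-straight arc under a forcing close to rung 0's — perturbative stagnation-zero analysis

Lane `ns-filament-19175-p1` (g7); helper file `--supports stmt-NavierStokesRegularity-21220`, route-independent.

SETTING (abstract, so that later rungs reuse it).  `x : ℝ → ℝ³` is a `C²` unit-speed curve through the rung-0 waist point
`x 0 = P = (√Γ/5, 0, 0)` whose tangent stays within `θ` of the rung-0 direction `e = (0, 1/√2, 1/√2)` on all of `ℝ`, and
which solves `x″ t = c t • x′ t × (V(x t) + f t)` for SOME scalar function `c` (`V y = ½ y − (21/5) e₃ × y`: frame drift at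
the datum's `α = 21/5`) and a differentiable forcing `f` with `‖f t − U t‖ ≤ ε₀ √Γ`, `‖f′ t − U′ t‖ ≤ ε₁`, `U` the frozen
rung-0 partner forcing of `…RungModelArcTools`.  The model rung R1 is the case `c = η χ` (cut-off local induction), `f = U`;
the true partner field of a near-straight partner evaluated along `x` is the intended later instance.

RESULTS (`w t = ⟪x′ t, V(x t) + f t⟫` the slip):
* `cutoff_slip_hasDerivAt` — `w′ = ½ + ⟪f′, x′⟫` for ANY coefficient function `c` (the binormal acceleration is orthogonal
  to `V(x) + f`; `⟪x′, V′ x′⟫ = ½`);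
* `arc_displacement_le`, `arc_norm_ge` — `‖x t − ℓ t‖ ≤ θ|t|` and `‖x t‖ ≥ (1 − θ)|t|` (`ℓ t = P + t e`);
* `slip_sub_profile_le` — `|w t − √Γ F(t/√Γ)| ≤ θ(3√Γ + 10|t|) + 2ε₀√Γ` with rung 0's profile `F`;
* `slip_deriv_sub_le` — `|w′ t − (½ + ⟪U′ t, e⟫)| ≤ 12θ + ε₁` (`⟪U′ t, e⟫ = F′(t/√Γ) − ½` is rung 0's axial strain).
The stagnation-zero package (existence, uniqueness on `ℝ`, location, waist, tilt, supercritical slope window) built on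
these is `…RungModelArcZero.lean`.

HONEST FRAMING.  Perturbation bookkeeping for the MODEL rung of a HYPOTHETICAL filament box; nothing here is a claim about
Navier–Stokes regularity or blow-up.
-/

set_option linter.dupNamespace false -- `Theorems.…Theorems`-style path/namespace repetition is the tree convention

noncomputable section

namespace Summit.NavierStokesRegularity.NavierStokesRegularity.Theorems

open Set Function Filter Real
open Literature.Analysis.FluidPDE
open scoped InnerProductSpace Topology

namespace SelectionBoxRJRung

/-! ### The slip law for an arbitrary coefficient function -/

/-- **Slip law with cut-off.**  Let `x` be `C²` with unit speed and `x″ t = c t • x′ t × (V(x t) + f t)`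
(`V y = ½ y − α e₃ × y`, any scalar function `c`, `f` differentiable).  Then `w t = ⟪x′ t, V(x t) + f t⟫` has
`w′ t = ½ + ⟪f′ t, x′ t⟫`: the acceleration is orthogonal to `V(x) + f`, and `⟪x′, V′ x′⟫ = ½‖x′‖²`. [folklore] -/
theorem cutoff_slip_hasDerivAt {α : ℝ} {c : ℝ → ℝ} {f x : ℝ → EuclideanSpace ℝ (Fin 3)}
    (hx : ContDiff ℝ 2 x) (hunit : ∀ t, ‖deriv x t‖ = 1)
    (hode : ∀ t, iteratedDeriv 2 x t = c t • cross (deriv x t)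
      ((1 / 2 : ℝ) • x t - α • cross (EuclideanSpace.single 2 1) (x t) + f t))
    (hf : Differentiable ℝ f) (t : ℝ) :
    HasDerivAt (fun s => ⟪deriv x s,
        ((1 / 2 : ℝ) • x s - α • cross (EuclideanSpace.single 2 1) (x s)) + f s⟫_ℝ)
      (1 / 2 + ⟪deriv f t, deriv x t⟫_ℝ) t := by
  have hxd : Differentiable ℝ x := hx.differentiable (by norm_num)
  have hTd : Differentiable ℝ (deriv x) := hx.differentiable_deriv_two
  have h2 : iteratedDeriv 2 x = deriv (deriv x) := by
    rw [iteratedDeriv_succ, iteratedDeriv_one]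
  have hx'' : deriv (deriv x) t = c t • cross (deriv x t)
      ((1 / 2 : ℝ) • x t - α • cross (EuclideanSpace.single 2 1) (x t) + f t) := by
    rw [← h2, hode t]
  -- the drift as a continuous linear map
  set A : EuclideanSpace ℝ (Fin 3) →L[ℝ] EuclideanSpace ℝ (Fin 3) :=
    (1 / 2 : ℝ) • ContinuousLinearMap.id ℝ (EuclideanSpace ℝ (Fin 3)) -
      α • crossCLM (EuclideanSpace.single (2 : Fin 3) (1 : ℝ)) with hAdef
  have hA : ∀ y, A y = (1 / 2 : ℝ) • y - α • cross (EuclideanSpace.single (2 : Fin 3) (1 : ℝ)) y :=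
    fun y => by simp [hAdef]
  have hAx : HasDerivAt (fun s => A (x s)) (A (deriv x t)) t :=
    A.hasFDerivAt.comp_hasDerivAt t (hxd t).hasDerivAt
  have hF : HasDerivAt (fun s => A (x s) + f s) (A (deriv x t) + deriv f t) t := hAx.add (hf t).hasDerivAt
  have hprod := (hTd t).hasDerivAt.inner ℝ hF
  have hfun : (fun s => ⟪deriv x s,
      ((1 / 2 : ℝ) • x s - α • cross (EuclideanSpace.single 2 1) (x s)) + f s⟫_ℝ) =
      fun s => ⟪deriv x s, A (x s) + f s⟫_ℝ := by
    funext s; rw [hA]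
  rw [hfun]
  refine hprod.congr_deriv ?_
  -- `⟪x″, A x + f⟫ = 0` and `⟪x′, A x′⟫ = ½`
  have horth : ⟪deriv (deriv x) t, A (x t) + f t⟫_ℝ = 0 := by
    rw [hx'', ← hA, real_inner_smul_left, TransverseReductionRCensus.inner_cross_self_right, mul_zero]
  have hAA : ⟪deriv x t, A (deriv x t)⟫_ℝ = 1 / 2 := by
    rw [hA, inner_sub_right, inner_smul_right, inner_smul_right, real_inner_self_eq_norm_sq, hunit t,
      real_inner_comm, TransverseReductionRCensus.inner_cross_self_right]
    ring
  rw [horth, inner_add_right, hAA, real_inner_comm]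
  ring

/-! ### Geometry of a near-straight arc through the waist point -/

/-- `‖ℓ t‖² = Γ/25 + t²` for the rung-0 line `ℓ t = (√Γ/5, 0, 0) + t e` (`Γ ≥ 0`). [folklore] -/
theorem norm_sq_line (Γ t : ℝ) (hΓ : 0 ≤ Γ) :
    ‖(WithLp.toLp 2 ![Real.sqrt Γ / 5, 0, 0] : EuclideanSpace ℝ (Fin 3)) +
        t • WithLp.toLp 2 ![0, (Real.sqrt 2)⁻¹, (Real.sqrt 2)⁻¹]‖ ^ 2 = Γ / 25 + t ^ 2 := by
  rw [pt₁, VortexFilament.norm_sq_toLp_three]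
  have hs := inv_sqrt_two_mul_self
  have hG : Real.sqrt Γ * Real.sqrt Γ = Γ := Real.mul_self_sqrt hΓ
  linear_combination (2 * t ^ 2) * hs + (1 / 25) * hG

/-- `|t| ≤ ‖ℓ t‖`. [folklore] -/
theorem abs_le_norm_line (Γ t : ℝ) (hΓ : 0 ≤ Γ) :
    |t| ≤ ‖(WithLp.toLp 2 ![Real.sqrt Γ / 5, 0, 0] : EuclideanSpace ℝ (Fin 3)) +
        t • WithLp.toLp 2 ![0, (Real.sqrt 2)⁻¹, (Real.sqrt 2)⁻¹]‖ := by
  have h := norm_sq_line Γ t hΓ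
  have hn := norm_nonneg ((WithLp.toLp 2 ![Real.sqrt Γ / 5, 0, 0] : EuclideanSpace ℝ (Fin 3)) +
        t • WithLp.toLp 2 ![0, (Real.sqrt 2)⁻¹, (Real.sqrt 2)⁻¹])
  have : |t| ^ 2 ≤ ‖(WithLp.toLp 2 ![Real.sqrt Γ / 5, 0, 0] : EuclideanSpace ℝ (Fin 3)) +
        t • WithLp.toLp 2 ![0, (Real.sqrt 2)⁻¹, (Real.sqrt 2)⁻¹]‖ ^ 2 := by
    rw [h, sq_abs]; nlinarith
  exact abs_le_of_sq_le_sq' this hn |>.2 |> fun _ => by nlinarith [this, abs_nonneg t, hn]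

/-- **Displacement of a near-straight arc from the rung-0 line.**  If `x` is differentiable with `x 0 = P` and
`‖x′ s − e‖ ≤ θ` for all `s`, then `‖x t − ℓ t‖ ≤ θ|t|` (`ℓ t = P + t e`; mean value inequality for `x − ℓ`). [folklore] -/
theorem arc_displacement_le {Γ θ : ℝ} {x : ℝ → EuclideanSpace ℝ (Fin 3)} (hxd : Differentiable ℝ x)
    (hx0 : x 0 = WithLp.toLp 2 ![Real.sqrt Γ / 5, 0, 0])
    (hθ : ∀ s, ‖deriv x s - WithLp.toLp 2 ![0, (Real.sqrt 2)⁻¹, (Real.sqrt 2)⁻¹]‖ ≤ θ) (t : ℝ) :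
    ‖x t - ((WithLp.toLp 2 ![Real.sqrt Γ / 5, 0, 0] : EuclideanSpace ℝ (Fin 3)) +
        t • WithLp.toLp 2 ![0, (Real.sqrt 2)⁻¹, (Real.sqrt 2)⁻¹])‖ ≤ θ * |t| := by
  set P : EuclideanSpace ℝ (Fin 3) := WithLp.toLp 2 ![Real.sqrt Γ / 5, 0, 0] with hP
  set e : EuclideanSpace ℝ (Fin 3) := WithLp.toLp 2 ![0, (Real.sqrt 2)⁻¹, (Real.sqrt 2)⁻¹] with he
  set d : ℝ → EuclideanSpace ℝ (Fin 3) := fun s => x s - (P + s • e) with hd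
  have hdd : ∀ s, HasDerivAt d (deriv x s - e) s := fun s =>
    (hxd s).hasDerivAt.sub (hasDerivAt_line P e s)
  have hdiff : ∀ s ∈ (univ : Set ℝ), DifferentiableAt ℝ d s := fun s _ => (hdd s).differentiableAt
  have hbound : ∀ s ∈ (univ : Set ℝ), ‖deriv d s‖ ≤ θ := fun s _ => by rw [(hdd s).deriv]; exact hθ s
  have h := Convex.norm_image_sub_le_of_norm_deriv_le hdiff hbound convex_univ (mem_univ 0) (mem_univ t)
  have hd0 : d 0 = 0 := by simp [hd, hx0, hP]
  rw [hd0, sub_zero, sub_zero, Real.norm_eq_abs] at h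
  simpa [hd] using h

/-- **Radial growth of a near-straight arc:** `(1 − θ)|t| ≤ ‖x t‖` under the hypotheses of `arc_displacement_le`
(`‖ℓ t‖ ≥ |t|`). [folklore] -/
theorem arc_norm_ge {Γ θ : ℝ} (hΓ : 0 ≤ Γ) {x : ℝ → EuclideanSpace ℝ (Fin 3)} (hxd : Differentiable ℝ x)
    (hx0 : x 0 = WithLp.toLp 2 ![Real.sqrt Γ / 5, 0, 0])
    (hθ : ∀ s, ‖deriv x s - WithLp.toLp 2 ![0, (Real.sqrt 2)⁻¹, (Real.sqrt 2)⁻¹]‖ ≤ θ) (t : ℝ) :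
    (1 - θ) * |t| ≤ ‖x t‖ := by
  have h1 := arc_displacement_le hxd hx0 hθ t
  have h2 := abs_le_norm_line Γ t hΓ
  have h3 := norm_sub_norm_le ((WithLp.toLp 2 ![Real.sqrt Γ / 5, 0, 0] : EuclideanSpace ℝ (Fin 3)) +
        t • WithLp.toLp 2 ![0, (Real.sqrt 2)⁻¹, (Real.sqrt 2)⁻¹]) (x t)
  rw [norm_sub_rev] at h1
  nlinarith [h1, h2, h3, abs_nonneg t]


/-! ### Comparison of the slip with the rung-0 profile -/

/-- `‖(√Γ/5, 0, 0)‖ = √Γ/5` (`Γ ≥ 0`). [folklore] -/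
theorem norm_waist (Γ : ℝ) (hΓ : 0 ≤ Γ) :
    ‖(WithLp.toLp 2 ![Real.sqrt Γ / 5, 0, 0] : EuclideanSpace ℝ (Fin 3))‖ = Real.sqrt Γ / 5 := by
  have h := norm_sq_line Γ 0 hΓ
  simp only [zero_smul, add_zero] at h
  have hG : 0 ≤ Real.sqrt Γ / 5 := by positivity
  have hG2 : (Real.sqrt Γ / 5) ^ 2 = Γ / 25 + 0 ^ 2 := by
    rw [div_pow, Real.sq_sqrt hΓ]; ring
  exact (pow_left_inj₀ (norm_nonneg _) hG two_ne_zero).1 (h.trans hG2.symm)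

/-- **The slip of a near-straight arc is `C⁰`-close to rung 0's profile.**  Under the abstract hypotheses of this file
(near-straight arc through the waist point, forcing `ε₀√Γ`-close to the frozen rung-0 forcing):
`|w t − √Γ·F(t/√Γ)| ≤ θ((3 + ε₀)√Γ + 10|t|) + ε₀√Γ`, where `√Γ·F(t/√Γ)` is rung 0's slip along the straight filament
(`line_slip_closed_form`).  The three error sources: tangent tilt against `V(x) + f` (size `≤ (47/10)‖x‖ + (8/5)√Γ + ε₀√Γ`),
displacement `‖x − ℓ‖ ≤ θ|t|` through the drift, and the forcing error. [folklore] -/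
theorem slip_sub_profile_le {Γ θ ε₀ : ℝ} (hΓ : 0 < Γ) (hθ0 : 0 ≤ θ)
    (U : ℝ → EuclideanSpace ℝ (Fin 3))
    (hU : ∀ t, U t = (2 * Γ / Real.pi / (4 * Γ / 25 + 1 + t ^ 2)) •
      ((2 * Real.sqrt Γ / 5) • (WithLp.toLp 2 ![0, (Real.sqrt 2)⁻¹, (Real.sqrt 2)⁻¹] : EuclideanSpace ℝ (Fin 3)) -
        t • WithLp.toLp 2 ![(1:ℝ), 0, 0]))
    {x f : ℝ → EuclideanSpace ℝ (Fin 3)} (hxd : Differentiable ℝ x) (hunit : ∀ t, ‖deriv x t‖ = 1)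
    (hx0 : x 0 = WithLp.toLp 2 ![Real.sqrt Γ / 5, 0, 0])
    (hθ : ∀ s, ‖deriv x s - WithLp.toLp 2 ![0, (Real.sqrt 2)⁻¹, (Real.sqrt 2)⁻¹]‖ ≤ θ)
    (hf0 : ∀ t, ‖f t - U t‖ ≤ ε₀ * Real.sqrt Γ)
    (w : ℝ → ℝ) (hw : ∀ t, w t = ⟪deriv x t,
        ((1 / 2 : ℝ) • x t - (21 / 5 : ℝ) • cross (EuclideanSpace.single 2 1) (x t)) + f t⟫_ℝ) (t : ℝ) :
    |w t - Real.sqrt Γ * (4 / (5 * Real.pi) / (4 / 25 + 1 / Γ + (t / Real.sqrt Γ) ^ 2) + (t / Real.sqrt Γ) / 2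
        - 21 / 25 * (Real.sqrt 2)⁻¹)| ≤ θ * ((3 + ε₀) * Real.sqrt Γ + 10 * |t|) + ε₀ * Real.sqrt Γ := by
  set P : EuclideanSpace ℝ (Fin 3) := WithLp.toLp 2 ![Real.sqrt Γ / 5, 0, 0] with hP
  set e : EuclideanSpace ℝ (Fin 3) := WithLp.toLp 2 ![0, (Real.sqrt 2)⁻¹, (Real.sqrt 2)⁻¹] with he
  have hG : 0 < Real.sqrt Γ := Real.sqrt_pos.2 hΓ
  have hε₀ : 0 ≤ ε₀ := by
    have h := (norm_nonneg _).trans (hf0 0)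
    nlinarith
  -- the drift as a continuous linear map
  set A : EuclideanSpace ℝ (Fin 3) →L[ℝ] EuclideanSpace ℝ (Fin 3) :=
    (1 / 2 : ℝ) • ContinuousLinearMap.id ℝ (EuclideanSpace ℝ (Fin 3)) -
      (21 / 5 : ℝ) • crossCLM (EuclideanSpace.single (2 : Fin 3) (1 : ℝ)) with hAdef
  have hA : ∀ y, A y = (1 / 2 : ℝ) • y - (21 / 5 : ℝ) • cross (EuclideanSpace.single (2 : Fin 3) (1 : ℝ)) y :=
    fun y => by simp [hAdef]
  have hAn : ∀ y, ‖A y‖ ≤ 47 / 10 * ‖y‖ := fun y => by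
    rw [hA]
    have := norm_drift_le (21 / 5 : ℝ) y
    norm_num at this
    linarith
  -- rung 0's slip in closed form
  have hw0 := line_slip_closed_form hΓ U hU t
  rw [← he, ← hP] at hw0
  -- decomposition `w − w₀ = ⟪x′ − e, A x + f⟫ + ⟪e, A (x − ℓ)⟫ + ⟪e, f − U⟫`
  have hdec : w t - Real.sqrt Γ * (4 / (5 * Real.pi) / (4 / 25 + 1 / Γ + (t / Real.sqrt Γ) ^ 2) + (t / Real.sqrt Γ) / 2
        - 21 / 25 * (Real.sqrt 2)⁻¹) =
      ⟪deriv x t - e, A (x t) + f t⟫_ℝ + ⟪e, A (x t - (P + t • e))⟫_ℝ + ⟪e, f t - U t⟫_ℝ := by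
    rw [← hw0, hw t, ← hA, ← hA]
    simp only [map_sub, map_add, inner_sub_left, inner_sub_right, inner_add_right]
    ring
  rw [hdec]
  -- sizes
  have hxn : ‖x t‖ ≤ Real.sqrt Γ / 5 + |t| := by
    have h := liaModel_position_bound hxd hunit t
    rwa [hx0, hP, norm_waist Γ hΓ.le] at h
  have hUn := norm_U_le hΓ U hU t
  have hfn : ‖f t‖ ≤ 8 / 5 * Real.sqrt Γ + ε₀ * Real.sqrt Γ := by
    have := norm_sub_norm_le (f t) (U t)
    linarith [hf0 t]
  have he1 : ‖e‖ = 1 := norm_tangent₁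
  have h1 : |⟪deriv x t - e, A (x t) + f t⟫_ℝ| ≤ θ * (47 / 10 * (Real.sqrt Γ / 5 + |t|) + (8 / 5 * Real.sqrt Γ + ε₀ * Real.sqrt Γ)) := by
    calc |⟪deriv x t - e, A (x t) + f t⟫_ℝ| ≤ ‖deriv x t - e‖ * ‖A (x t) + f t‖ := abs_real_inner_le_norm _ _
      _ ≤ θ * (47 / 10 * (Real.sqrt Γ / 5 + |t|) + (8 / 5 * Real.sqrt Γ + ε₀ * Real.sqrt Γ)) := by
          refine mul_le_mul (hθ t) ?_ (norm_nonneg _) hθ0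
          calc ‖A (x t) + f t‖ ≤ ‖A (x t)‖ + ‖f t‖ := norm_add_le _ _
            _ ≤ 47 / 10 * ‖x t‖ + ‖f t‖ := by linarith [hAn (x t)]
            _ ≤ 47 / 10 * (Real.sqrt Γ / 5 + |t|) + (8 / 5 * Real.sqrt Γ + ε₀ * Real.sqrt Γ) := by
                nlinarith [hxn, hfn]
  have h2 : |⟪e, A (x t - (P + t • e))⟫_ℝ| ≤ 47 / 10 * (θ * |t|) := by
    calc |⟪e, A (x t - (P + t • e))⟫_ℝ| ≤ ‖e‖ * ‖A (x t - (P + t • e))‖ := abs_real_inner_le_norm _ _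
      _ = ‖A (x t - (P + t • e))‖ := by rw [he1, one_mul]
      _ ≤ 47 / 10 * ‖x t - (P + t • e)‖ := hAn _
      _ ≤ 47 / 10 * (θ * |t|) := by
          have := arc_displacement_le hxd hx0 hθ t
          rw [← hP, ← he] at this
          linarith
  have h3 : |⟪e, f t - U t⟫_ℝ| ≤ ε₀ * Real.sqrt Γ := by
    calc |⟪e, f t - U t⟫_ℝ| ≤ ‖e‖ * ‖f t - U t‖ := abs_real_inner_le_norm _ _
      _ = ‖f t - U t‖ := by rw [he1, one_mul]
      _ ≤ ε₀ * Real.sqrt Γ := hf0 t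
  have habs := (abs_add_le _ _).trans (add_le_add ((abs_add_le _ _).trans (add_le_add h1 h2)) h3)
  refine habs.trans ?_
  have ht : 0 ≤ |t| := abs_nonneg t
  nlinarith [mul_nonneg hθ0 ht, mul_nonneg hθ0 hG.le, mul_nonneg hθ0 (mul_nonneg hε₀ hG.le)]

/-- **Axial derivative bounds.**  Under the abstract hypotheses (`C²` unit-speed arc solving the cut-off equation with
forcing `f`, `‖x′ − e‖ ≤ θ`, `‖f′ − U′‖ ≤ ε₁`): `|w′ t − (½ + ⟪U′ t, e⟫)| ≤ 12θ + ε₁`. [folklore] -/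
theorem slip_deriv_sub_le {Γ θ ε₁ : ℝ} (hΓ : 0 < Γ)
    (U : ℝ → EuclideanSpace ℝ (Fin 3))
    (hU : ∀ t, U t = (2 * Γ / Real.pi / (4 * Γ / 25 + 1 + t ^ 2)) •
      ((2 * Real.sqrt Γ / 5) • (WithLp.toLp 2 ![0, (Real.sqrt 2)⁻¹, (Real.sqrt 2)⁻¹] : EuclideanSpace ℝ (Fin 3)) -
        t • WithLp.toLp 2 ![(1:ℝ), 0, 0]))
    {x f : ℝ → EuclideanSpace ℝ (Fin 3)} {c : ℝ → ℝ} (hx : ContDiff ℝ 2 x) (hunit : ∀ t, ‖deriv x t‖ = 1)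
    (hθ : ∀ s, ‖deriv x s - WithLp.toLp 2 ![0, (Real.sqrt 2)⁻¹, (Real.sqrt 2)⁻¹]‖ ≤ θ)
    (hode : ∀ t, iteratedDeriv 2 x t = c t • cross (deriv x t)
      ((1 / 2 : ℝ) • x t - (21 / 5 : ℝ) • cross (EuclideanSpace.single 2 1) (x t) + f t))
    (hf : Differentiable ℝ f) (hf1 : ∀ t, ‖deriv f t - deriv U t‖ ≤ ε₁)
    (w : ℝ → ℝ) (hw : ∀ t, w t = ⟪deriv x t,
        ((1 / 2 : ℝ) • x t - (21 / 5 : ℝ) • cross (EuclideanSpace.single 2 1) (x t)) + f t⟫_ℝ) (t : ℝ) :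
    |deriv w t - (1 / 2 + ⟪deriv U t, (WithLp.toLp 2 ![0, (Real.sqrt 2)⁻¹, (Real.sqrt 2)⁻¹] : EuclideanSpace ℝ (Fin 3))⟫_ℝ)|
      ≤ 12 * θ + ε₁ := by
  set e : EuclideanSpace ℝ (Fin 3) := WithLp.toLp 2 ![0, (Real.sqrt 2)⁻¹, (Real.sqrt 2)⁻¹] with he
  have hwf : w = fun s => ⟪deriv x s,
      ((1 / 2 : ℝ) • x s - (21 / 5 : ℝ) • cross (EuclideanSpace.single 2 1) (x s)) + f s⟫_ℝ := funext hw
  rw [hwf, (cutoff_slip_hasDerivAt hx hunit hode hf t).deriv]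
  have hsplit : ⟪deriv f t, deriv x t⟫_ℝ - ⟪deriv U t, e⟫_ℝ =
      ⟪deriv U t, deriv x t - e⟫_ℝ + ⟪deriv f t - deriv U t, deriv x t⟫_ℝ := by
    rw [inner_sub_right, inner_sub_left]; ring
  have h1 : |⟪deriv U t, deriv x t - e⟫_ℝ| ≤ 12 * θ := by
    calc |⟪deriv U t, deriv x t - e⟫_ℝ| ≤ ‖deriv U t‖ * ‖deriv x t - e‖ := abs_real_inner_le_norm _ _
      _ ≤ 12 * θ := mul_le_mul (norm_U_deriv_le hΓ U hU t) (hθ t) (norm_nonneg _) (by norm_num)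
  have h2 : |⟪deriv f t - deriv U t, deriv x t⟫_ℝ| ≤ ε₁ := by
    calc |⟪deriv f t - deriv U t, deriv x t⟫_ℝ| ≤ ‖deriv f t - deriv U t‖ * ‖deriv x t‖ := abs_real_inner_le_norm _ _
      _ ≤ ε₁ := by rw [hunit t, mul_one]; exact hf1 t
  have : 1 / 2 + ⟪deriv f t, deriv x t⟫_ℝ - (1 / 2 + ⟪deriv U t, e⟫_ℝ) =
      ⟪deriv U t, deriv x t - e⟫_ℝ + ⟪deriv f t - deriv U t, deriv x t⟫_ℝ := by rw [← hsplit]; ring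
  rw [this]
  exact (abs_add_le _ _).trans (add_le_add h1 h2)

end SelectionBoxRJRung

end Summit.NavierStokesRegularity.NavierStokesRegularity.Theorems
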